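import Summits.HodgeConjecture.CorCM.Model.WeightDual
import Summits.HodgeConjecture.CorCM.Model.ModelAxiomsOfRows
import Summits.HodgeConjecture.CorCM.Model.AlgDualityHolds
import HarnessLib

/-!
# COR-CM row Fg6 `Fact_weightDual` for the model of record, over the displayed binders only

Cell `pub-hodgecm2` (COR-CM), slot b19 (row Fg6 executor).  `CorCM/Model/WeightDual.lean` (model-2, filed by b19) proves
F6 `Universe.Fact_weightDual` for `Model.universeOf hHD hI hU h₃` GIVEN its `ModelAxioms` record `M`
(`Model.universeOf_fact_weightDual … (M)`, the form consumed by the model chain `Assembly/ModelChain.lean`).  The record itself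
is a tree theorem over the displayed binders: `Model.modelAxioms_of_rows hHD hI hU h₃ hR h28` (b10, `Model/ModelAxiomsOfRows.lean`)
with the M22 input `h28 := Model.universeOf_algDuality hHD hI hU h₃` (model-1, `Model/AlgDualityHolds.lean`).  Composing the three
gives the row's EXACT type over `{hHD, hI, hU, h₃, hR}` (count rule R7-2 / ACK condition C3 of the cell), and its
`picardCMUniverse` reading.  Nothing new is proved here.
-/

noncomputable section

open Literature.AlgebraicGeometry.Motives
open Literature.AlgebraicGeometry.ShimuraVarieties
open Literature.NumberTheory.Automorphic
open Literature.NumberTheory.Automorphic.PicardCM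
open Literature.AlgebraicGeometry.HodgeTheory

namespace Summit.HodgeConjecture.CorCM

namespace Model

/-- **Row Fg6 `Fact_weightDual` for `universeOf`, over the displayed binders `hHD hI hU h₃` and Riemann's theorem `hR`
(B02)**: the `ModelAxioms` record of `Model.universeOf_fact_weightDual` is supplied by `Model.modelAxioms_of_rows` with the
M22 input `Model.universeOf_algDuality`. [cite: Pohlmann1968, §1 Thm 1] [cite: VoisinHodgeI2002, §5.3.2 Thm. 5.30] -/
theorem universeOf_fact_weightDual_of_riemann (hHD : exists_isReal_hodgeModel)
    (hI : hodgePQ_independent_of_hodgeModel) (hU : BallQuotientUniformisedDatum) (h₃ : CMAbelianVarietyRealised)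
    (hR : DeligneMilne1982_Thm_6_20_full) : (universeOf hHD hI hU h₃).Fact_weightDual :=
  universeOf_fact_weightDual hHD hI hU h₃ (modelAxioms_of_rows hHD hI hU h₃ hR (universeOf_algDuality hHD hI hU h₃))

/-- **Row Fg6 for the model of record `picardCMUniverse hHD hI h₁ h₃`** (= `universeOf` at the packaged ball-quotient datum),
over the displayed binders and `hR`. [cite: Pohlmann1968, §1 Thm 1] [cite: VoisinHodgeI2002, §5.3.2 Thm. 5.30] -/
theorem picardCMUniverse_fact_weightDual_of_riemann (hHD : exists_isReal_hodgeModel)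
    (hI : hodgePQ_independent_of_hodgeModel) (h₁ : BallQuotientUniformised) (h₃ : CMAbelianVarietyRealised)
    (hR : DeligneMilne1982_Thm_6_20_full) : (picardCMUniverse hHD hI h₁ h₃).Fact_weightDual :=
  universeOf_fact_weightDual_of_riemann hHD hI (ballQuotientUniformisedDatum_of h₁) h₃ hR

end Model

end Summit.HodgeConjecture.CorCM

end
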